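import Mathlib
import Literature.AlgebraicGeometry.HodgeTheory.SemiregularityMap
import Literature.AlgebraicGeometry.Motives.AbelianVariety

/-!
Sketch for crux idea `rank-one-secant-square-seeds` (crux stmt-HodgeConjecture-13941,
`PadicSemiregularLift.SemiregularSeedsOnAnchors`).  First lemmas of the line, typed over existing
declarations only.  Nothing here is proved; these are the signatures the card's `First lemma:`
field refers to.
-/

namespace Summit.HodgeConjecture.HodgeConjecture.Cruxes.SemiregularSeedsOnAnchors.RankOneSecantSquareSeeds

open Literature.AlgebraicGeometry.HodgeTheory

/-- K2 (typed shadow).  TRANSPORT OF SEMIREGULARITY: if the semiregularity maps of two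
Atiyah–trace algebras `A` (the object `G` on `M`) and `B` (the object `Φ G` on `M'`) are intertwined,
`σ'_k ∘ e = f_k ∘ σ_k`, by a linear equivalence `e : Ext²(G,G) ≃ Ext²(ΦG,ΦG)` and injective maps
`f_k : H^{k+2}(M, Ω^k) → H^{k+2}(M', Ω^k)` (for a Fourier–Mukai equivalence: `e = Φ` on `Ext²`,
`f = Φ_*` on the Hochschild summand `HΩ_{-2}`, an isomorphism — Markman arXiv:2502.03415 Rem. after
8.3.5, Perry Def. 2.4/Rem. 2.5), then `G` semiregular ⇒ `Φ G` semiregular. -/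
def SemiregularTransport : Prop :=
  ∀ (𝕜 : Type) [CommRing 𝕜] (A B : AtiyahTraceAlgebra.{0, 0} 𝕜)
    (e : A.Ext 2 0 ≃ₗ[𝕜] B.Ext 2 0)
    (f : ∀ k : ℕ, A.Coh (k + 2) k →ₗ[𝕜] B.Coh (k + 2) k),
    (∀ k, Function.Injective (f k)) →
    (∀ (k : ℕ) (x : A.Ext 2 0),
        B.semiregularityComponent k (e x) = f k (A.semiregularityComponent k x)) →
    A.IsSemiregular → B.IsSemiregular

/-- K1 (typed shadow, linear-algebra core of the KÜNNETH CRITERION).  For a box product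
`G = F₁ ⊠ F₂` on `X₁ × X₂` the semiregularity map restricted to the Künneth block
`Extᵃ(F₁,F₁) ⊗ Extᵇ(F₂,F₂)` (`a + b = 2`) is, component by component, the tensor product
`σ⁽ᵃ⁾_{F₁} ⊗ σ⁽ᵇ⁾_{F₂}` of the "degree-`a` semiregularity maps" `σ⁽ᵃ⁾ : Extᵃ(F,F) → ⊕ᵢ H^{a+i}(Ω^i)`
(`σ⁽⁰⁾(id) = ch F`, `σ⁽¹⁾ = (tr, tr(· At))`, `σ⁽²⁾ =` BF's `σ`), landing in pairwise distinct
Künneth–Hodge components; so `G` is semiregular iff these tensor products are injective, i.e. iff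
each factor map is.  Over a field the tensor product of two injective linear maps is injective: -/
def KunnethBlockInjective : Prop :=
  ∀ (K : Type) [Field K] (E₁ T₁ E₂ T₂ : Type) [AddCommGroup E₁] [Module K E₁]
    [AddCommGroup T₁] [Module K T₁] [AddCommGroup E₂] [Module K E₂] [AddCommGroup T₂] [Module K T₂]
    (σ₁ : E₁ →ₗ[K] T₁) (σ₂ : E₂ →ₗ[K] T₂),
    Function.Injective σ₁ → Function.Injective σ₂ →
      Function.Injective (TensorProduct.map σ₁ σ₂)

/-- K1' (typed shadow of the 1-SEMIREGULARITY CRITERION on an abelian surface, informal content: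
for a simple sheaf `F` on an abelian surface `X` over `k = k̄`, the degree-1 map
`σ⁽¹⁾ = (tr, tr(· At_F)) : Ext¹(F,F) → H¹(X,𝒪) ⊕ H²(X,Ω¹) ≅ H¹(𝒪) ⊕ H⁰(T_X)^∨` satisfies
`⟨σ⁽¹⁾(ξ), (η, w)⟩ = ω(ξ, ξ_η + ξ_w)` for the Mukai–Serre form `ω` on `Ext¹(F,F)` and the tangent
vectors `ξ_η, ξ_w` of the `X × X̂`-orbit `(x, L) ↦ τₓ^* F ⊗ L`; hence `σ⁽¹⁾` is injective iff the
orbit map is étale at `F`, i.e. iff `ext¹(F,F) = 4` — Mukai vectors with `v² = 2`).  The abstract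
statement: a vector orthogonal, for a nondegenerate (reflexive) bilinear form, to a spanning family
is zero. -/
def OrbitSpansImpliesOneSemiregular : Prop :=
  ∀ (K : Type) [Field K] (E : Type) [AddCommGroup E] [Module K E] [FiniteDimensional K E]
    (ω : LinearMap.BilinForm K E), ω.Nondegenerate →
    ∀ (ι : Type) (t : ι → E), Submodule.span K (Set.range t) = ⊤ →
      ∀ ξ : E, (∀ i, ω ξ (t i) = 0) → ξ = 0

end Summit.HodgeConjecture.HodgeConjecture.Cruxes.SemiregularSeedsOnAnchors.RankOneSecantSquareSeeds
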